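import Literature.AlgebraicGeometry.HodgeTheory.HomComplexSigma
import Literature.AlgebraicGeometry.HodgeTheory.HomComplexExact
import Literature.AlgebraicGeometry.HodgeTheory.HomComplexSupertraceDinatural
import Literature.AlgebraicGeometry.HodgeTheory.DerivedDescentNatTrans
import Literature.AlgebraicGeometry.HodgeTheory.ShiftedHomMapComp
import Literature.AlgebraicGeometry.HodgeTheory.HomComplexSigmaSingle
import Literature.AlgebraicGeometry.HodgeTheory.ComplexAtiyahPower
import HarnessLib

/-!
# `σ_q` of a strictly perfect complex is invariant under isomorphisms of complexes (SIGMA-INVARIANCE, step (I5-iso))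

PROMOTED LITERATURE COPY (librarian protocol (b); DEFREQ-CoherentISemiregular, cell pub-hsemireg) of the generic, conjecture-free
`Summits/Ventures/HSemireg/HomComplexSigmaConj.lean` — namespace now `Literature.AlgebraicGeometry.HodgeTheory`, names kept; cell words (seats, ventures) = provenance.

Cell `pub-hsemireg`, target seat t-7 (assembly) over the general-structure seat gs-g4's SIGMA-INVARIANCE-PLAN pieces; K2-MIN sequel to
`HomComplexSigma.lean` (`HomComplex.sigmaC`, `IsISemiregularC`).  HONEST FRAMING: kernel plumbing on the cell's real carriers; NOT a door,
NOT a fact, nothing about any variety or conjecture; nothing here says HC / HC_CM / HC_AV is proved.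

MAIN RESULTS (all proved):
* `HomComplex.sigmaC_conj` — for an isomorphism `φ : K• ≅ K'•` of bounded complexes of finite locally free `𝒪_X`-modules (same bounds
  `[a, b]`) and `x ∈ Ext²(K•, K•) = Hom_D(Q K•, (Q K•)⟦2⟧)`, the conjugate `x' := Q(φ⁻¹) ≫ x ≫ Q(φ)⟦2⟧ ∈ Ext²(K'•, K'•)` has
  `σ_q^{K'}(x') = σ_q^{K}(x)` in `Hom_D(Q 𝒪_X[0], (Q Ω^q[0])⟦q+2⟧)`;
* `HomComplex.IsISemiregularC.of_iso`, `HomComplex.isISemiregularC_iff_of_iso` — `I`-semiregularity (the clause of `sigmaAdmissible` in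
  `PerfectComplexSigmaDoor.lean`) is a property of the complex up to isomorphism of complexes.

INGREDIENTS — the naturality in `K•` of every factor of `σ_q(x) = Q(unit) ≫ Φ_K(x · ι• · At(K•)^q) ≫ Q(Tr•)⟦q+2⟧`:
(s1) unit: `HomComplexUnit.unit_comp_map_eq_unit_comp_premap` (t-7) — here `unitQ_comp_map_inv`;
(s2)/(s4) functoriality of `Φ_{K'}` in the second variable: `shiftedHomMap_mk₀_comp` (gs-g4, `ShiftedHomMapComp.lean`), `shiftedHomMap_comp_mk₀`
(gs-g4, `HomComplexSigmaSingle.lean`);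
(s3) `ι · At^q`: `complexAtiyahPowerFrom_naturality` (gs-g4, `ComplexAtiyahPower.lean`) — here `extMulAtiyahPower_conj`;
(s5) `Φ` in the FIRST variable: `premapNatTrans` (`𝓗om•(ψ, –)` as a natural transformation of endofunctors; Mathlib `map₂CochainComplex`
supplies `NatTrans.CommShift`; = gs-g4's probe `prenat`) and `shiftedHomMap_premap`, from gs-g4's `shiftedHomMap_comp_shift_map`
(`DerivedDescentNatTrans.lean`, on seat p3's `natTrans_commShift_liftNatTrans`);
(s6)–(s8) the supertrace: `supertraceH_dinatural`, from gs-g4's `supertrace_dinatural` (`HomComplexSupertraceDinatural.lean`, on p3's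
`contract_dinatural`), `premap_comp_map` (t-7) and the transport `twistHodgeIsoG`; plus `premap_id`, `premapNatTrans_inv_hom_app` and a
`ShiftedHom` reassociation across the degree cast of `sigmaC`.

KERNEL NOTE (t-7 `HomComplexSigma.lean`; gs-g4 plan §4, re-measured here): a composition
`(homFunctor K').map (((twistHodgeFunctor X q).mapHomologicalComplex _).map φ) ≫ supertraceH X K' …` — whose well-typedness needs the
definitional triviality `(homFunctor K').obj (((twistHodgeFunctor X q).mapHomologicalComplex _).obj K') ≡ (homFunctor K').obj (twistHodgeComplex X q K')`
— exhausts the KERNEL's memory (even for `theorem … := rfl` of a term with itself).  Every statement below is therefore spelled so that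
compositions are SYNTACTICALLY well-typed: `twistHodgeComplexMap` (a `def` with declared ends `twistHodgeComplex X q _`),
`(premapNatTrans _).app (twistHodgeComplex …)`, `(homFunctor _).map`; `set_option backward.isDefEq.respectTransparency false` crosses the
`Functor.comp_obj` / `homFunctor`-vs-`map` seams inside proofs.  NOT here: invariance under QUASI-isomorphisms (needs «`𝓗om•(f, L•)` is a
quasi-isomorphism for a quasi-isomorphism `f` of strictly perfect complexes», gs-g4 plan (I7)).
[cite: BuchweitzFlenner2003, Def. 4.1 and §4 (trace map)]
-/

noncomputable section

open CategoryTheory CategoryTheory.Limits AlgebraicGeometry Opposite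

namespace Literature.AlgebraicGeometry.HodgeTheory

open Literature.AlgebraicGeometry.Modules Literature.AlgebraicGeometry.Motives

namespace HomComplex

/-! ## §1 `𝓗om•(ψ, –)` as a natural transformation and the naturality of `Φ_K` in `K•` -/

section PremapDescent

universe w₁ u₁

variable {S : Type u₁} [CommRing S] (X : Over (Spec (CommRingCat.of S))) [HasDerivedCategory.{w₁} X.left.Modules]
  {K K' : CochainComplex X.left.Modules ℤ} (ψ : K ⟶ K')
  (a b : ℤ) [K.IsStrictlyGE a] [K.IsStrictlyLE b] [K'.IsStrictlyGE a] [K'.IsStrictlyLE b]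
  (hK : ∀ p, IsFiniteLocallyFree (K.X p)) (hK' : ∀ p, IsFiniteLocallyFree (K'.X p))

/-- `𝓗om•(ψ, –) : 𝓗om•(E'•, –) ⟶ 𝓗om•(E•, –)` as a natural transformation of endofunctors of cochain complexes (Mathlib's
`map₂CochainComplex` in the first variable of the internal-Hom bifunctor); its components are `HomComplex.premap`. [folklore] -/
def premapNatTrans (Y : Scheme.{w₁}) {E E' : CochainComplex Y.Modules ℤ} (ψ : E ⟶ E') : homFunctor Y E' ⟶ homFunctor Y E :=
  ((sheafHomBifunctor Y).flip.map₂CochainComplex).flip.map (dualComplexMap Y ψ)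

omit [HasDerivedCategory X.left.Modules] in
/-- The components of `premapNatTrans` are `premap`. [cite: BuchweitzFlenner2003, Def. 4.1] -/
@[simp]
lemma premapNatTrans_app (Y : Scheme.{w₁}) {E E' : CochainComplex Y.Modules ℤ} (ψ : E ⟶ E') (F : CochainComplex Y.Modules ℤ) :
    (premapNatTrans Y ψ).app F = premap Y ψ F := rfl

/-- `𝓗om•(ψ, –)` commutes with the shifts (Mathlib `BifunctorShift`: naturality of the first-variable shift isomorphism in the
second variable). [folklore] -/
instance premapNatTrans_commShift (Y : Scheme.{w₁}) {E E' : CochainComplex Y.Modules ℤ} (ψ : E ⟶ E') :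
    NatTrans.CommShift (premapNatTrans Y ψ) ℤ := by
  unfold premapNatTrans; infer_instance

set_option backward.isDefEq.respectTransparency false in
/-- **Naturality of `Φ_K` in `K•` on shifted Homs**: for `y : Q A ⟶ (Q B)⟦n⟧`,
`Φ_{K'}(y) · Q(𝓗om•(ψ, B)) = Q(𝓗om•(ψ, A)) · Φ_K(y)` — the descended `𝓗om•(ψ, –)` is a shift-compatible natural transformation
`Φ_{K'} ⟶ Φ_K` (seat gs-g4's `derivedLiftNatTrans` / `shiftedHomMap_comp_shift_map`, `DerivedDescentNatTrans.lean`, at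
`τ := premapNatTrans X.left ψ`), here in `ShiftedHom.comp` form.  (`𝓗om•(ψ, F)` is spelled `(premapNatTrans …).app F` = `premap … F` by
`rfl`.) [cite: BuchweitzFlenner2003, Def. 4.1] -/
theorem shiftedHomMap_premap {A B : CochainComplex X.left.Modules ℤ} {n : ℤ}
    (y : ShiftedHom (DerivedCategory.Q.obj A) (DerivedCategory.Q.obj B) n) :
    (shiftedHomMap (homFunctor X.left K') (homFunctor_isInvertedBy X K' a b hK') y).comp
        (ShiftedHom.mk₀ (0 : ℤ) rfl (DerivedCategory.Q.map ((premapNatTrans X.left ψ).app B))) (zero_add n) =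
      (ShiftedHom.mk₀ (0 : ℤ) rfl (DerivedCategory.Q.map ((premapNatTrans X.left ψ).app A))).comp
        (shiftedHomMap (homFunctor X.left K) (homFunctor_isInvertedBy X K a b hK) y) (add_zero n) := by
  rw [ShiftedHom.comp_mk₀, ShiftedHom.mk₀_comp]
  exact shiftedHomMap_comp_shift_map (homFunctor_isInvertedBy X K' a b hK') (homFunctor_isInvertedBy X K a b hK)
    (premapNatTrans X.left ψ) y

end PremapDescent

/-! ## §2 Helpers: `𝓗om•(𝟙, –) = 𝟙`, `φ ⊗ 1_{Ω^q}` in the `twistHodgeComplex` spelling, dinaturality of `supertraceH` -/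

section Helpers

universe w₁ u₁

variable {S : Type u₁} [CommRing S] (X : Over (Spec (CommRingCat.of S))) {K K' : CochainComplex X.left.Modules ℤ}
  (hK : ∀ p, IsFiniteLocallyFree (K.X p)) (hK' : ∀ p, IsFiniteLocallyFree (K'.X p))

/-- `ψ ⊗ 1_G : E• ⊗ G ⟶ E'• ⊗ G` (the twist functor applied termwise to `ψ`), with the `twistG` spelling of its ends. [folklore] -/
abbrev twistGMapE (Y : Scheme.{w₁}) (G : Y.Modules) {E E' : CochainComplex Y.Modules ℤ} (ψ : E ⟶ E') : twistG Y G E ⟶ twistG Y G E' :=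
  ((twistFunctor Y G).mapHomologicalComplex (ComplexShape.up ℤ)).map ψ

/-- `𝓗om•(𝟙_E, F) = 𝟙`. [cite: BuchweitzFlenner2003, Def. 4.1] -/
lemma premap_id (Y : Scheme.{w₁}) (E F : CochainComplex Y.Modules ℤ) : premap Y (𝟙 E) F = 𝟙 _ := by
  simp [premap, dualComplexMap_id, HomologicalComplex.mapBifunctorMap]

/-- `φ ⊗ 1_{Ω^q} : K• ⊗ Ω^q ⟶ K'• ⊗ Ω^q` with source and target SPELLED `twistHodgeComplex X q _` (a `def`, so that
`(homFunctor _).map` of it composes with `supertraceH` without the kernel comparing the two object spellings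
`twistHodgeComplex X q K'` / `((twistHodgeFunctor X q).mapHomologicalComplex _).obj K'` under `homFunctor` — that comparison
exhausts the kernel's memory, cf. the KERNEL NOTE of `HomComplexSigma.lean`). [folklore] -/
def twistHodgeComplexMap (q : ℕ) (φ : K ⟶ K') : twistHodgeComplex X q K ⟶ twistHodgeComplex X q K' :=
  ((twistHodgeFunctor X q).mapHomologicalComplex (ComplexShape.up ℤ)).map φ

/-- Unfolding `twistHodgeComplexMap`. [cite: BuchweitzFlenner2003, Def. 4.1] -/
lemma twistHodgeComplexMap_eq (q : ℕ) (φ : K ⟶ K') :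
    twistHodgeComplexMap X q φ = ((twistHodgeFunctor X q).mapHomologicalComplex (ComplexShape.up ℤ)).map φ := rfl

/-- The two spellings of `φ ⊗ 1_{Ω^q}` agree along `twistHodgeIsoG` (identities on objects; a square at the level of complexes
of MODULES, which the kernel checks cheaply). [cite: BuchweitzFlenner2003, Def. 4.1] -/
lemma twistHodgeComplexMap_comp_twistHodgeIsoG_hom (q : ℕ) (φ : K ⟶ K') :
    twistHodgeComplexMap X q φ ≫ (twistHodgeIsoG X K' q).hom = (twistHodgeIsoG X K q).hom ≫ twistGMapE X.left (hodgeSheaf X q) φ := by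
  simp only [twistHodgeComplexMap, twistHodgeIsoG, Iso.refl_hom, Category.comp_id, Category.id_comp]

set_option backward.isDefEq.respectTransparency false in
/-- **Dinaturality of `supertraceH` in the complex**: `𝓗om•(K'•, φ ⊗ 1) ≫ Tr•^H_{K'} = 𝓗om•(φ, K• ⊗ Ω^q) ≫ Tr•^H_K` for a chain map
`φ : K• ⟶ K'•` — from `supertrace_dinatural`, the naturality `premap_comp_map` of `𝓗om•(φ, –)`, and the transport `twistHodgeIsoG`;
stated in the spellings `(homFunctor _).map (twistHodgeComplexMap …)` / `(premapNatTrans …).app (twistHodgeComplex …)` under which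
every composition is syntactically well-typed. [cite: BuchweitzFlenner2003, §4 (trace map)] -/
theorem supertraceH_dinatural (q : ℕ) (φ : K ⟶ K') :
    (homFunctor X.left K').map (twistHodgeComplexMap X q φ) ≫ supertraceH X K' hK' q =
      (premapNatTrans X.left φ).app (twistHodgeComplex X q K) ≫ supertraceH X K hK q := by
  unfold supertraceH
  rw [← Category.assoc, ← Functor.map_comp, twistHodgeComplexMap_comp_twistHodgeIsoG_hom, Functor.map_comp, Category.assoc]
  have h3 : (homFunctor X.left K').map (twistGMapE X.left (hodgeSheaf X q) φ) ≫ supertrace X.left (hodgeSheaf X q) K' hK' =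
      premap X.left φ (twistG X.left (hodgeSheaf X q) K) ≫ supertrace X.left (hodgeSheaf X q) K hK :=
    (supertrace_dinatural X.left (hodgeSheaf X q) hK hK' φ (twistGMapE X.left (hodgeSheaf X q) φ) fun _ => rfl).symm
  rw [h3]
  have h4 : (homFunctor X.left K').map (twistHodgeIsoG X K q).hom ≫ premap X.left φ (twistG X.left (hodgeSheaf X q) K) =
      (premapNatTrans X.left φ).app (twistHodgeComplex X q K) ≫ (homFunctor X.left K).map (twistHodgeIsoG X K q).hom :=
    (premap_comp_map X.left φ (twistHodgeIsoG X K q).hom).symm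
  rw [← Category.assoc, h4, Category.assoc]

/-- Reassociation across a CAST of the total degree: `(Y · f) · g = Y · (f ≫ g)` for degree-`0` classes `f`, `g`, where the outer
composition lands in a degree `d'` only propositionally equal to `d` (the shape of the last composition in `sigmaC`). [cite: BuchweitzFlenner2003, Def. 4.1] -/
lemma shiftedHom_comp_mk₀_comp_mk₀_cast {C : Type*} [Category C] [HasShift C ℤ] {T₁ T₂ T₃ T₄ : C} {d d' : ℤ}
    (Y : ShiftedHom T₁ T₂ d) (f : T₂ ⟶ T₃) (g : T₃ ⟶ T₄) (h : (0 : ℤ) + d = d') :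
    (Y.comp (ShiftedHom.mk₀ (0 : ℤ) rfl f) (zero_add d)).comp (ShiftedHom.mk₀ (0 : ℤ) rfl g) h =
      Y.comp (ShiftedHom.mk₀ (0 : ℤ) rfl (f ≫ g)) h := by
  rw [ShiftedHom.comp_assoc Y (ShiftedHom.mk₀ (0 : ℤ) rfl f) (ShiftedHom.mk₀ (0 : ℤ) rfl g) (zero_add d) (add_zero 0)
    (by rw [add_zero]; exact h), ShiftedHom.mk₀_comp_mk₀]

end Helpers

/-! ## §3 Invariance of `σ_q` under isomorphisms of strictly perfect complexes -/

section Invariance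

universe w₁ u₁

variable {S : Type u₁} [CommRing S] (X : Over (Spec (CommRingCat.of S))) [HasDerivedCategory.{w₁} X.left.Modules]
  {K K' : CochainComplex X.left.Modules ℤ} (a b : ℤ) [K.IsStrictlyGE a] [K.IsStrictlyLE b] [K'.IsStrictlyGE a] [K'.IsStrictlyLE b]
  (hK : ∀ p, IsFiniteLocallyFree (K.X p)) (hK' : ∀ p, IsFiniteLocallyFree (K'.X p))

/-- `complexAtiyahPowerFrom_naturality` in the `twistHodgeComplexMap` spelling. [cite: BuchweitzFlenner2003, §4 (At^k)] -/
theorem complexAtiyahPowerFrom_naturality' (q : ℕ) (f : K ⟶ K') :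
    (complexAtiyahPowerFrom q K).comp (ShiftedHom.mk₀ (0 : ℤ) rfl (DerivedCategory.Q.map (twistHodgeComplexMap X q f))) (zero_add _) =
      (ShiftedHom.mk₀ (0 : ℤ) rfl (DerivedCategory.Q.map f)).comp (complexAtiyahPowerFrom q K') (add_zero _) :=
  complexAtiyahPowerFrom_naturality q f

/-- Step A: the Atiyah argument of the conjugate class: `(φ⁻¹ · x · φ) · ι•At^q_{K'} = φ⁻¹ · ((x · ι•At^q_K) · (φ ⊗ 1))`.
[cite: BuchweitzFlenner2003, §4 (At^k)] -/
theorem extMulAtiyahPower_conj (φ : K ≅ K') (q : ℕ)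
    (x : ShiftedHom (DerivedCategory.Q.obj K) (DerivedCategory.Q.obj K) (2 : ℤ)) :
    extMulAtiyahPower X K' q
        ((ShiftedHom.mk₀ (0 : ℤ) rfl (DerivedCategory.Q.map φ.inv)).comp
          (x.comp (ShiftedHom.mk₀ (0 : ℤ) rfl (DerivedCategory.Q.map φ.hom)) (zero_add 2)) (add_zero 2)) =
      (ShiftedHom.mk₀ (0 : ℤ) rfl (DerivedCategory.Q.map φ.inv)).comp
        ((extMulAtiyahPower X K q x).comp
          (ShiftedHom.mk₀ (0 : ℤ) rfl (DerivedCategory.Q.map (twistHodgeComplexMap X q φ.hom))) (zero_add _))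
        (add_zero _) := by
  rw [extMulAtiyahPower_eq_comp q K', extMulAtiyahPower_eq_comp q K x, shiftedHom_mk₀_comp_comp, shiftedHom_comp_mk₀_comp,
    ← complexAtiyahPowerFrom_naturality' X q φ.hom, shiftedHom_comp_comp_mk₀]

set_option backward.isDefEq.respectTransparency false in
/-- Step C, head: `Q(unit_{K'}) ≫ Q(𝓗om•(K'•, φ⁻¹)) = Q(unit_K) ≫ Q(𝓗om•(φ⁻¹, K•))` (naturality of the unit). [cite: BuchweitzFlenner2003, Def. 4.1] -/
theorem unitQ_comp_map_inv (φ : K ≅ K') :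
    unitQ X K' a b ≫ DerivedCategory.Q.map ((homFunctor X.left K').map φ.inv) =
      unitQ X K a b ≫ DerivedCategory.Q.map ((premapNatTrans X.left φ.inv).app K) := by
  unfold unitQ
  rw [← Functor.map_comp, ← Functor.map_comp]
  exact congrArg DerivedCategory.Q.map (unit_comp_map_eq_unit_comp_premap X.left K' a b K φ.inv)

set_option backward.isDefEq.respectTransparency false in
omit [HasDerivedCategory X.left.Modules] in
/-- Step C, middle: `𝓗om•(φ⁻¹, K•) ≫ 𝓗om•(φ, K•) = 𝟙`. [cite: BuchweitzFlenner2003, Def. 4.1] -/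
theorem premapNatTrans_inv_hom_app (φ : K ≅ K') (F : CochainComplex X.left.Modules ℤ) :
    (premapNatTrans X.left φ.inv).app F ≫ (premapNatTrans X.left φ.hom).app F = 𝟙 _ := by
  rw [premapNatTrans_app, premapNatTrans_app, ← premap_comp, Iso.hom_inv_id, premap_id]
  rfl

set_option backward.isDefEq.respectTransparency false in
/-- **Invariance of `σ_q` under isomorphisms of complexes**: for an isomorphism `φ : K• ≅ K'•` of bounded complexes of finite
locally free `𝒪_X`-modules (same bounds `[a, b]`) and `x ∈ Ext²(K•, K•) = Hom_D(Q K•, (Q K•)⟦2⟧)`, the conjugate class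
`x' := Q(φ⁻¹) ≫ x ≫ Q(φ)⟦2⟧ ∈ Ext²(K'•, K'•)` has the SAME semiregularity value: `σ_q^{K'}(x') = σ_q^K(x)` in
`Hom_D(Q 𝒪_X[0], (Q Ω^q[0])⟦q+2⟧)`.  Proof: unit naturality (`HomComplexUnit.unit_comp_map_eq_unit_comp_premap`), naturality
of `ι · At^q` (`complexAtiyahPowerFrom_naturality`), functoriality of `Φ_{K'}` in the second variable (`shiftedHomMap_comp_mk₀` /
`shiftedHomMap_mk₀_comp`), naturality of `Φ` in the FIRST variable (`shiftedHomMap_premap`) and dinaturality of the supertrace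
(`supertraceH_dinatural`); then `𝓗om•(φ⁻¹, K) ≫ 𝓗om•(φ, K) = 𝟙`. [cite: BuchweitzFlenner2003, Def. 4.1] -/
theorem sigmaC_conj (φ : K ≅ K') (q : ℕ) (x : ShiftedHom (DerivedCategory.Q.obj K) (DerivedCategory.Q.obj K) (2 : ℤ)) :
    sigmaC X K' a b hK' q
        ((ShiftedHom.mk₀ (0 : ℤ) rfl (DerivedCategory.Q.map φ.inv)).comp
          (x.comp (ShiftedHom.mk₀ (0 : ℤ) rfl (DerivedCategory.Q.map φ.hom)) (zero_add 2)) (add_zero 2)) =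
      sigmaC X K a b hK q x := by
  -- Steps A and B: the middle factor
  have hB : phiMulAtiyahPower X K' a b hK' q
      ((ShiftedHom.mk₀ (0 : ℤ) rfl (DerivedCategory.Q.map φ.inv)).comp
        (x.comp (ShiftedHom.mk₀ (0 : ℤ) rfl (DerivedCategory.Q.map φ.hom)) (zero_add 2)) (add_zero 2)) =
      (ShiftedHom.mk₀ (0 : ℤ) rfl (DerivedCategory.Q.map ((homFunctor X.left K').map φ.inv))).comp
        ((shiftedHomMap (homFunctor X.left K') (homFunctor_isInvertedBy X K' a b hK') (extMulAtiyahPower X K q x)).comp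
          (ShiftedHom.mk₀ (0 : ℤ) rfl (DerivedCategory.Q.map ((homFunctor X.left K').map (twistHodgeComplexMap X q φ.hom))))
          (zero_add _)) (add_zero _) := by
    unfold phiMulAtiyahPower
    rw [extMulAtiyahPower_conj, shiftedHomMap_mk₀_comp, shiftedHomMap_comp_mk₀]
  -- the tail `Q(𝓗om•(K', φ ⊗ 1)) ≫ Q(Tr•^H_{K'}) = Q(𝓗om•(φ, K ⊗ Ω^q)) ≫ Q(Tr•^H_K)`
  have hT : DerivedCategory.Q.map ((homFunctor X.left K').map (twistHodgeComplexMap X q φ.hom)) ≫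
      DerivedCategory.Q.map (supertraceH X K' hK' q) =
      DerivedCategory.Q.map ((premapNatTrans X.left φ.hom).app (twistHodgeComplex X q K)) ≫
        DerivedCategory.Q.map (supertraceH X K hK q) := by
    rw [← Functor.map_comp, ← Functor.map_comp, supertraceH_dinatural X hK hK' q φ.hom]
  unfold sigmaC
  rw [hB, ShiftedHom.mk₀_comp_mk₀_assoc, unitQ_comp_map_inv X a b φ, ← shiftedHom_mk₀_comp_comp,
    shiftedHom_comp_mk₀_comp_mk₀_cast, hT, ← shiftedHom_comp_mk₀_comp_mk₀_cast, shiftedHom_mk₀_comp_comp,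
    shiftedHomMap_premap X φ.hom a b hK hK', ShiftedHom.mk₀_comp_mk₀_assoc, Category.assoc, ← Functor.map_comp,
    premapNatTrans_inv_hom_app, CategoryTheory.Functor.map_id, Category.comp_id]
  rfl

/-- Conjugation by an isomorphism of complexes is injective on `Ext²(K•, K•) = Hom_D(Q K•, (Q K•)⟦2⟧)`. [cite: BuchweitzFlenner2003, Def. 4.1] -/
theorem conj_injective (φ : K ≅ K') :
    Function.Injective fun x : ShiftedHom (DerivedCategory.Q.obj K) (DerivedCategory.Q.obj K) (2 : ℤ) =>
      (ShiftedHom.mk₀ (0 : ℤ) rfl (DerivedCategory.Q.map φ.inv)).comp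
        (x.comp (ShiftedHom.mk₀ (0 : ℤ) rfl (DerivedCategory.Q.map φ.hom)) (zero_add 2)) (add_zero 2) := by
  intro x₁ x₂ h
  simp only [ShiftedHom.mk₀_comp, ShiftedHom.comp_mk₀] at h
  exact (cancel_mono _).1 ((cancel_epi _).1 h)

/-- **`I`-semiregularity is invariant under isomorphisms of complexes** (one direction; the other is the same statement for
`φ.symm`): if `K'•` is `I`-semiregular then so is any `K• ≅ K'•` (same bounds, finite locally free terms).
[cite: BuchweitzFlenner2003, §5 (I-semiregular)] -/
theorem IsISemiregularC.of_iso (φ : K ≅ K') {I : Set ℕ} (h : IsISemiregularC X K' a b hK' I) :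
    IsISemiregularC X K a b hK I := by
  intro x₁ x₂ hx
  apply conj_injective X φ
  apply h
  funext q
  dsimp only
  rw [sigmaC_conj X a b hK hK' φ q x₁, sigmaC_conj X a b hK hK' φ q x₂]
  exact congr_fun hx q

/-- **`IsISemiregularC` is a property of the complex up to isomorphism**: for `φ : K• ≅ K'•` (bounded complexes of finite locally
free modules with the same bounds), `K•` is `I`-semiregular iff `K'•` is — so the semiregularity clause of `sigmaAdmissible`
(`PerfectComplexSigmaDoor.lean`) does not depend on the chosen complex within its isomorphism class.
[cite: BuchweitzFlenner2003, §5 (I-semiregular)] -/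
theorem isISemiregularC_iff_of_iso (φ : K ≅ K') (I : Set ℕ) :
    IsISemiregularC X K a b hK I ↔ IsISemiregularC X K' a b hK' I :=
  ⟨IsISemiregularC.of_iso X a b hK' hK φ.symm, IsISemiregularC.of_iso X a b hK hK' φ⟩

end Invariance

end HomComplex

end Literature.AlgebraicGeometry.HodgeTheory

end
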